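import Mathlib
import Summits.Ventures.PercRepro2.LocRows
import Summits.Ventures.PercRepro2.SwRow
import Summits.Ventures.PercRepro2.SwOut
import Summits.Ventures.PercRepro2.SwAllRow
import Summits.Ventures.PercRepro2.SwOutAll
import Summits.Ventures.PercRepro2.SwOutArmFlip
import Summits.Ventures.PercRepro2.SwOutArms
import Summits.Ventures.PercRepro2.SwOutArmOrbit
import Summits.Ventures.PercRepro2.SwOutArmCube
import Summits.Ventures.PercRepro2.SwOutArmThm
import Summits.Ventures.PercRepro2.SwOutCoreDefs
import Summits.Ventures.PercRepro2.SwOutCoreKey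
import Summits.Ventures.PercRepro2.SwOutCoreShadowUnion
import Summits.Ventures.PercRepro2.SwOutBigBlockDefs
import Summits.Ventures.PercRepro2.SwOutMixedBaseDefs
import Summits.Ventures.PercRepro2.SwOutMixedBaseClasses
import Summits.Ventures.PercRepro2.SwOutMixedBaseHull
import Summits.Ventures.PercRepro2.SwOutMixedBaseDual
import Summits.Ventures.PercRepro2.SwOutMixedCore
import Summits.Ventures.PercRepro2.SwOutMixedPartCoreKey
import Summits.Ventures.PercRepro2.SwOutMixedPartOrbitDefs

/-!
# The coarse orbits of a mixed block stay in the raw cube (blind cell PercRepro2, night-4 g19,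
2026-08-27; proofs/NIGHT4-G19.md §5 (ii))

At a non-leaking point `q` of the raw cube of a mixed base whose arms are CONNECTED, the flip of a
union `W` of coarse arms is again a point of the raw cube (**`flip_armClosed_eq_mixedReal`**: the
point `toggleW` with the classes inside `W` toggled — edge by edge: an edge of a class touches `W`
iff its class lies in `W`, `SwOutMixedPartOrbitDefs`; an edge of no class touches no vertex of the
hull), and every point of the coarse orbit of a core-free realisation is a realisation
(**`exists_mixedReal_of_mem_orbit`**, from `exists_armsUnion_of_mem_orbit`).  With (G1)
(`mem_outClass_iff`) the orbit points of the class are non-leaking: the coarse orbit of an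
escaping point of a mixed block stays in the block.  WITHOUT the connectivity of the h-piece this
FAILS: a coarse arm would be one piece of the h-piece and its flip is a class point outside the
cube (the dead edges to the two pieces of different colours) — the reason the partition needs
the h-piece connected.
-/


namespace Summit.Ventures.PercRepro2

namespace BigBlock

open Hull LocRows

variable {V : Type*} {E : Type*}

open scoped Classical

section Orbit

variable {ι κ : Type*} {ends : E → Sym2 V} {σ : Config E} {h u p : V} {U : ι → Set V} {Ah : Set V}
  {F : κ → Set V}

variable (hb : MixedBase ends σ h u p U Ah F)
include hb

section Flip

variable (hup : ∃ e, ends e = s(u, p)) (hdead : ∃ e y, ends e = s(p, y) ∧ y ∈ Ah)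
  (hconnU : ∀ j, ∀ x ∈ U j, ∀ y ∈ U j, y ∈ cluster ends (fun e => decide (e ∈ within ends (U j))) x)
  (hconnA : ∀ x ∈ Ah, ∀ y ∈ Ah, y ∈ cluster ends (fun e => decide (e ∈ within ends Ah)) x)
  (hconnF : ∀ k, ∀ x ∈ F k, ∀ y ∈ F k, y ∈ cluster ends (fun e => decide (e ∈ within ends (F k))) x)
  {q : Pt ι κ} (hqR : ¬ LeakR q) (hqB : ¬ LeakB q)
  {W : Set V} (hW : ArmClosed ends (mixedReal ends u p U Ah F σ q) h W)
include hup hdead hconnU hconnA hconnF hqR hqB hW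

/-- **The flip of a union of coarse arms is a point of the raw cube**: the classes inside `W`
toggled. -/
theorem MixedBase.flip_armClosed_eq_mixedReal [Nonempty ι] :
    flip ends W (mixedReal ends u p U Ah F σ q) =
      mixedReal ends u p U Ah F σ (toggleW u p U Ah F q W) := by
  have hhW : h ∉ W := fun hh => (hW.subset h hh).2 rfl
  have hUiff := fun j => hb.U_subset_iff hup hconnU hqR hqB hW j
  funext e
  -- which class?
  by_cases hU : ∃ j, e ∈ touches ends (U j)
  · obtain ⟨j, hj⟩ := hU
    have hmem : e ∈ touches ends W ↔ U j ⊆ W := by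
      obtain ⟨x, y, hxy, hx, hy⟩ := hb.ends_of_touches_U hj
      constructor
      · rintro ⟨z, hzW, w, hzw⟩
        have hz : z = x ∨ z = y := by
          rw [hxy, Sym2.eq_iff] at hzw
          rcases hzw with ⟨h1, _⟩ | ⟨_, h2⟩
          · exact Or.inl h1.symm
          · exact Or.inr h2.symm
        rcases subset_or_disjoint_of_armClosed hW
            (fun v hv => ⟨hb.armsAll_subset_hull hup hqR hqB
                (Or.inl (Or.inl (Set.mem_iUnion.2 ⟨j, hv⟩))),
              fun h' => hb.h_notMem_U j (h' ▸ hv)⟩) (hconnU j) with hsub | hdisj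
        · exact hsub
        · exfalso
          rcases hz with rfl | rfl
          · exact hdisj z hx hzW
          · rcases hy with hy | rfl | rfl | ⟨hyh, hyu, hyp, hyo⟩
            · exact hdisj z hy hzW
            · exact hhW hzW
            · exact hdisj x hx ((hUiff j).2 hzW hx)
            · exact hb.not_mem_W_of_out hup hqR hqB hW hyh hyu hyp hyo hzW
      · intro hsub
        exact ⟨x, hsub hx, y, hxy⟩
    by_cases hsub : U j ⊆ W
    · rw [flip_apply_of_mem (hmem.2 hsub), hb.mixedReal_apply_U hj, hb.mixedReal_apply_U hj]
      simp only [toggleW, if_pos hsub]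
      cases q.1 j <;> simp
    · rw [flip_apply_of_notMem (fun h' => hsub (hmem.1 h')), hb.mixedReal_apply_U hj,
        hb.mixedReal_apply_U hj]
      simp only [toggleW, if_neg hsub]
  by_cases hA : e ∈ touches ends Ah
  · have hmem : e ∈ touches ends W ↔ Ah ⊆ W := by
      obtain ⟨x, y, hxy, hx, hy⟩ := hb.ends_of_touches_Ah hA
      constructor
      · rintro ⟨z, hzW, w, hzw⟩
        have hz : z = x ∨ z = y := by
          rw [hxy, Sym2.eq_iff] at hzw
          rcases hzw with ⟨h1, _⟩ | ⟨_, h2⟩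
          · exact Or.inl h1.symm
          · exact Or.inr h2.symm
        rcases subset_or_disjoint_of_armClosed hW
            (fun v hv => ⟨hb.armsAll_subset_hull hup hqR hqB (Or.inl (Or.inr hv)),
              fun h' => hb.h_notMem_Ah (h' ▸ hv)⟩) hconnA with hsub | hdisj
        · exact hsub
        · exfalso
          rcases hz with rfl | rfl
          · exact hdisj z hx hzW
          · rcases hy with hy | rfl | rfl | ⟨hyh, hyu, hyp, hyo⟩
            · exact hdisj z hy hzW
            · exact hhW hzW
            · exact hdisj x hx (hb.Ah_subset_of_mem hup hdead hconnA hqR hqB hW hzW hx)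
            · exact hb.not_mem_W_of_out hup hqR hqB hW hyh hyu hyp hyo hzW
      · intro hsub
        exact ⟨x, hsub hx, y, hxy⟩
    by_cases hsub : Ah ⊆ W
    · rw [flip_apply_of_mem (hmem.2 hsub), hb.mixedReal_apply_Ah hA, hb.mixedReal_apply_Ah hA]
      simp only [toggleW, if_pos hsub]
      cases q.2.1 <;> simp
    · rw [flip_apply_of_notMem (fun h' => hsub (hmem.1 h')), hb.mixedReal_apply_Ah hA,
        hb.mixedReal_apply_Ah hA]
      simp only [toggleW, if_neg hsub]
  by_cases hUP : e ∈ clsUP ends u p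
  · have hmem : e ∈ touches ends W ↔ u ∈ W := by
      have hup' : ends e = s(u, p) := hUP
      constructor
      · rintro ⟨z, hzW, w, hzw⟩
        rw [hup', Sym2.eq_iff] at hzw
        rcases hzw with ⟨h1, _⟩ | ⟨_, h2⟩
        · rw [← h1] at hzW; exact hzW
        · rw [← h2] at hzW; exact hb.u_mem_of_p_mem hup hqR hqB hW hzW
      · intro huW
        exact ⟨u, huW, p, hup'⟩
    by_cases huW : u ∈ W
    · rw [flip_apply_of_mem (hmem.2 huW), hb.mixedReal_apply_UP hUP, hb.mixedReal_apply_UP hUP]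
      simp only [toggleW, if_pos huW]
      cases q.2.2.1 <;> simp
    · rw [flip_apply_of_notMem (fun h' => huW (hmem.1 h')), hb.mixedReal_apply_UP hUP,
        hb.mixedReal_apply_UP hUP]
      simp only [toggleW, if_neg huW]
  by_cases hX : e ∈ clsExt ends u p Ah
  · have hmem : e ∈ touches ends W ↔ p ∈ W := by
      obtain ⟨z, hpz, hzu, hzA⟩ := hX
      have hzout : z ∉ W := by
        rcases hb.p_edges e z hpz with rfl | hz | ⟨hzh, hzp, hzo⟩
        · exact absurd rfl hzu
        · exact absurd hz hzA
        · exact hb.not_mem_W_of_out hup hqR hqB hW hzh hzu hzp hzo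
      constructor
      · rintro ⟨w, hwW, w', hww'⟩
        rw [hpz, Sym2.eq_iff] at hww'
        rcases hww' with ⟨h1, _⟩ | ⟨_, h2⟩
        · rw [← h1] at hwW; exact hwW
        · rw [← h2] at hwW; exact absurd hwW hzout
      · intro hpW
        exact ⟨p, hpW, z, hpz⟩
    by_cases hpW : p ∈ W
    · rw [flip_apply_of_mem (hmem.2 hpW), hb.mixedReal_apply_Ext hX, hb.mixedReal_apply_Ext hX]
      simp only [toggleW, if_pos hpW]
      cases q.2.2.2.1 <;> simp
    · rw [flip_apply_of_notMem (fun h' => hpW (hmem.1 h')), hb.mixedReal_apply_Ext hX,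
        hb.mixedReal_apply_Ext hX]
      simp only [toggleW, if_neg hpW]
  by_cases hF : ∃ k, e ∈ touches ends (F k)
  · obtain ⟨k, hk⟩ := hF
    have hmem : e ∈ touches ends W ↔ F k ⊆ W := by
      obtain ⟨x, y, hxy, hx, hy⟩ := hb.ends_of_touches_F hk
      constructor
      · rintro ⟨z, hzW, w, hzw⟩
        have hz : z = x ∨ z = y := by
          rw [hxy, Sym2.eq_iff] at hzw
          rcases hzw with ⟨h1, _⟩ | ⟨_, h2⟩
          · exact Or.inl h1.symm
          · exact Or.inr h2.symm
        rcases subset_or_disjoint_of_armClosed hW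
            (fun v hv => ⟨hb.armsAll_subset_hull hup hqR hqB (Or.inr (Set.mem_iUnion.2 ⟨k, hv⟩)),
              fun h' => hb.h_notMem_F k (h' ▸ hv)⟩) (hconnF k) with hsub | hdisj
        · exact hsub
        · exfalso
          rcases hz with rfl | rfl
          · exact hdisj z hx hzW
          · rcases hy with hy | rfl | ⟨hyh, hyu, hyp, hyo⟩
            · exact hdisj z hy hzW
            · exact hhW hzW
            · exact hb.not_mem_W_of_out hup hqR hqB hW hyh hyu hyp hyo hzW
      · intro hsub
        exact ⟨x, hsub hx, y, hxy⟩
    by_cases hsub : F k ⊆ W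
    · rw [flip_apply_of_mem (hmem.2 hsub), hb.mixedReal_apply_F hk, hb.mixedReal_apply_F hk]
      simp only [toggleW, if_pos hsub]
      cases q.2.2.2.2 k <;> simp
    · rw [flip_apply_of_notMem (fun h' => hsub (hmem.1 h')), hb.mixedReal_apply_F hk,
        hb.mixedReal_apply_F hk]
      simp only [toggleW, if_neg hsub]
  · -- no class: the edge touches neither `W` nor any class
    have hU' : ∀ j, e ∉ touches ends (U j) := fun j hj => hU ⟨j, hj⟩
    have hF' : ∀ k, e ∉ touches ends (F k) := fun k hk => hF ⟨k, hk⟩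
    have hnot : e ∉ touches ends W := by
      rintro ⟨z, hzW, w, hzw⟩
      have hzH := hb.hull_mixedReal_subset hup hqR hqB (hW.subset z hzW).1
      rcases hzH with ((hzh | hzu) | hzp) | hz
      · rw [hzh] at hzW; exact hhW hzW
      · rw [hzu] at hzw
        rcases hb.u_edges e w hzw with ⟨j, hj⟩ | hwp
        · exact hU' j ⟨w, hj, u, ends_swap hzw⟩
        · rw [hwp] at hzw; exact hUP hzw
      · rw [hzp] at hzw
        rcases hb.p_edges e w hzw with hwu | hw | ⟨_, _, hwo⟩
        · rw [hwu] at hzw; exact hUP (ends_swap hzw)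
        · exact hA ⟨w, hw, p, ends_swap hzw⟩
        · by_cases hwu : w = u
          · rw [hwu] at hzw; exact hUP (ends_swap hzw)
          · exact hX ⟨w, hzw, hwu, fun hw => hwo (Or.inl (Or.inr hw))⟩
      · rcases hz with (hz | hz) | hz
        · obtain ⟨j, hj⟩ := Set.mem_iUnion.1 hz
          exact hU' j ⟨z, hj, w, hzw⟩
        · exact hA ⟨z, hz, w, hzw⟩
        · obtain ⟨k, hk⟩ := Set.mem_iUnion.1 hz
          exact hF' k ⟨z, hk, w, hzw⟩
    rw [flip_apply_of_notMem hnot, MixedBase.mixedReal_apply_none hU' hA hUP hX hF',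
      MixedBase.mixedReal_apply_none hU' hA hUP hX hF']

end Flip

/-- **Every point of the coarse orbit of a core-free realisation is a realisation** (the arms
connected). -/
theorem MixedBase.exists_mixedReal_of_mem_orbit [Fintype E] [DecidableEq E] [Nonempty ι]
    (hup : ∃ e, ends e = s(u, p)) (hdead : ∃ e y, ends e = s(p, y) ∧ y ∈ Ah)
    (hconnU : ∀ j, ∀ x ∈ U j, ∀ y ∈ U j,
      y ∈ cluster ends (fun e => decide (e ∈ within ends (U j))) x)
    (hconnA : ∀ x ∈ Ah, ∀ y ∈ Ah, y ∈ cluster ends (fun e => decide (e ∈ within ends Ah)) x)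
    (hconnF : ∀ k, ∀ x ∈ F k, ∀ y ∈ F k,
      y ∈ cluster ends (fun e => decide (e ∈ within ends (F k))) x)
    {q : Pt ι κ} (hqR : ¬ LeakR q) (hqB : ¬ LeakB q)
    (hc : CoreFree ends (mixedReal ends u p U Ah F σ q) h) {ζ'' : Config E}
    (hζ'' : ζ'' ∈ orbit ends (allRed ends (mixedReal ends u p U Ah F σ q) h) h) :
    ∃ q' : Pt ι κ, ζ'' = mixedReal ends u p U Ah F σ q' := by
  obtain ⟨P, hP⟩ := exists_armsUnion_of_mem_orbit hc hζ''
  refine ⟨toggleW u p U Ah F q (armsUnion (arms ends (mixedReal ends u p U Ah F σ q) h) P), ?_⟩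
  rw [hP]
  exact hb.flip_armClosed_eq_mixedReal hup hdead hconnU hconnA hconnF hqR hqB
    (armClosed_armsUnion P)

end Orbit

end BigBlock

end Summit.Ventures.PercRepro2
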